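import Literature.Probability.Percolation.FlipFairKernel

/-!
# Pivotal points of a quad lie in its carrier

Route `Summits/CriticalPhenomena/CardyFormulaZ2/Theses/CardyMeckeFlip`, crux `MeckeRigidity`
(item stmt-CriticalPhenomena-14826), line `registered`, stub `stub_crossingUniqueness` (helper).

The pivotal predicate `QuadConfig.IsPivotalAt S x Q` of `FlipFairKernel.lean` (the characterised
parameter `Piv` of the crux) forces `x ∈ [Q]`: in the open-pivotal case `Q` itself is a crossed
sub-quad avoiding a ball around any point off the (compact) carrier; in the closed-pivotal case the
landing side `∂₂Q₁ ⊆ [Q]` of a crossed sub-quad meets every ball around `x`.  Consequence used by the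
flip calculus of the uniqueness stub: the toggled crossing pattern of a family of quads is unchanged
at points off their carriers (`toggledPattern` locality), so densities built from far-away quads are
flip-fair against test functions supported near the origin.
-/

noncomputable section

open Set Metric
open Literature.Probability.Percolation Literature.Probability.Percolation.QuadCrossing

namespace Summit.CriticalPhenomena.CardyFormulaZ2.Theorems.CardyMeckeFlip

variable {D : Set ℂ}

/-- The sides of a quad are nonempty. [folklore] -/
theorem quad_side_nonempty (Q : Quad D) (k : Fin 4) : (Q.side k).Nonempty := by
  match k with
  | 0 => exact ⟨Q (0, 0), (0, 0), rfl, rfl⟩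
  | 1 => exact ⟨Q (0, 0), (0, 0), rfl, rfl⟩
  | 2 => exact ⟨Q (1, 0), (1, 0), rfl, rfl⟩
  | 3 => exact ⟨Q (0, 1), (0, 1), rfl, rfl⟩

/-- **Pivotal points lie in the carrier**: `S.IsPivotalAt x Q → x ∈ [Q]`. [folklore] -/
theorem IsPivotalAt.mem_carrier {S : QuadConfig D} {x : ℂ} {Q : Quad D}
    (h : S.IsPivotalAt x Q) : x ∈ Q.carrier := by
  by_contra hx
  rcases h with ⟨hQ, hopen⟩ | ⟨-, hclosed⟩
  · -- off the compact carrier some ball around `x` misses `[Q]`, and `Q` itself is a crossed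
    -- sub-quad avoiding it
    have hopen' : IsOpen (Q.carrierᶜ) := Q.isCompact_carrier.isClosed.isOpen_compl
    obtain ⟨ε, hε, hball⟩ := Metric.isOpen_iff.mp hopen' x hx
    refine hopen ε hε Q ?_ Subset.rfl Subset.rfl hQ
    intro y hy
    exact ⟨hy, fun hyb => hball hyb hy⟩
  · -- every ball around `x` contains the (nonempty) side `∂₂Q₁ ⊆ [Q₁] ⊆ [Q]`, so `x ∈ closure [Q]`
    apply hx
    rw [← Q.isCompact_carrier.isClosed.closure_eq, Metric.mem_closure_iff]
    intro ε hε
    obtain ⟨Q₁, Q₂, -, -, h₁c, -, -, h₁2, -, -⟩ := hclosed ε hε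
    obtain ⟨y, hy⟩ := quad_side_nonempty Q₁ 2
    exact ⟨y, h₁c (Q₁.side_subset_carrier 2 hy), Metric.mem_ball'.mp (h₁2 hy)⟩

/-- Off the carriers of a finite family of quads, flipping toggles none of them: the toggled
pattern `{i | Qᵢ ∈ S} Δ {i | Piv S x Qᵢ}` is the crossing pattern. [folklore] -/
theorem setOf_xor_isPivotalAt_eq_of_forall_not_mem {n : ℕ} (S : QuadConfig D) (x : ℂ)
    (Q : Fin n → Quad D) (hx : ∀ i, x ∉ (Q i).carrier) :
    {i | Xor (Q i ∈ S) (S.IsPivotalAt x (Q i))} = {i | Q i ∈ S} := by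
  ext i
  have hi : ¬ S.IsPivotalAt x (Q i) := fun h => hx i (IsPivotalAt.mem_carrier h)
  simp [Xor, hi]

/-- **Pivotal points lie in the carrier, registered form** (sub-goal `isPivotalAt_mem_carrier` of
item stmt-CriticalPhenomena-14826). [folklore] -/
theorem isPivotalAt_mem_carrier : ∀ (D : Set ℂ) (S : QuadConfig D) (x : ℂ) (Q : Quad D), S.IsPivotalAt x Q → x ∈ Q.carrier := by
  intro D S x Q h
  exact IsPivotalAt.mem_carrier h

end Summit.CriticalPhenomena.CardyFormulaZ2.Theorems.CardyMeckeFlip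

end
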